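import Summits.BirchSwinnertonDyer.BirchSwinnertonDyer.Theorems.RamifiedHeegnerPairLeafPartnerGenusLabelB4
import Summits.BirchSwinnertonDyer.BirchSwinnertonDyer.Theorems.GoldfeldGoodTwistsLocalTwo
import Literature.NumberTheory.EllipticCurves.PAdicLFunctionQuadraticTwistBirchSharedPrimesProofs
import Literature.NumberTheory.Automorphic.QuadraticOrdersRhoResidues
import HarnessLib

/-!
# Crux U₁ `LeafRankOneUpperAtThree` (stmt-BirchSwinnertonDyer-26022) ∕ U₀ (26024), line `partnerdescent` — partner kernel part 22a:
# FRAME TRANSFER `W → V` for the `3`-good partner at the primes `ℓ ≠ 3`, and two bookkeeping lemmas for the (DISPLAY-L) assembly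

HONEST FRAMING (lead prover `bsd-line-rhp-p2` g59, explicit-unit seat, cell `bsd-wall`): a SUPPORT file (`--supports 26022 --as helper`)
for the registered stub (DISPLAY-L) `stub_partnerGenusDisplayLabelledAtThree` of the line of record `partnerdescent` v5 (U₁;
`splitkolyvagin0` v18 on U₀); consumed by part 22b (`…LeafPartnerGenusDisplayLabelled`, the assembly). It proves NO stub and closes NO
item; BSD is proved for no curve. Theorems only; no definition, no named fact, no `sorry`.

WHAT.
* §1 frame transfer `W → V` for `V = CV • W^{(−3)}` at every prime `ℓ ≠ 3`: equal conductor exponents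
  (`factorization_conductorNorm_partner`, from the tree's `factorization_conductorNorm_quadraticTwist_eq_of_not_dvd`, `−3 ≡ 1 (4)`, and
  `conductorNorm_int_smul`), hence `ℓ ∣ N_V ⟺ ℓ ∣ N_W` (`dvd_conductorNorm_partner_iff`), good reduction transfers
  (`hasGoodReductionAtPrime_partner_iff`), and `a_ℓ(W) = χ₋₃(ℓ)·a_ℓ(V)` with `χ₋₃(ℓ) = (if ℓ % 3 = 1 then 1 else −1)`
  (`frobeniusTrace_partner_chi`: odd `ℓ` by part 19 §1 `frobeniusTrace_partner` + `(−3∕ℓ)` by residue class, `Brandt.legendreSym_neg_three_eq`;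
  `ℓ = 2` by the tree's `GoldfeldGoodTwists.hasGoodReductionAtPrime_and_frobeniusTrace_of_smul_eq_quadraticTwist_two`, `−3 ≡ 5 (8)`).
  These feed the fact `shimuraCurve_heegnerSystem_genusThree` at `V` from the stub's `W`-frame (the `S`-frame `ℓ ∥ N_V`, the split
  clause, `ℓ ∤ Δ_min(V)` in (B5)) and the sign `a_ℓ(W) = χ₋₃(ℓ)a_ℓ(V)` of label (B4).
* §2 `chi3_mul`: `χ₋₃` is multiplicative on integers prime to `3` (the re-signing `c_m = χ₋₃(ℓ)c_{m/ℓ}` of (B4)/(B5));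
  `genusSign_eq_of_coe_eq`: the genus sign `genusSign θ σ` depends only on the complex values of `θ` and `σ θ` (so the (B3χ) pin
  «`σ′` restricts to `σ₃` on `K[3]`» makes the (B3) sign `ε_W = −ε·genusSign θ σ′` level-independent).
[cite: SilvermanATAEC1994, IV.9.4] [cite: SilvermanAEC2009, VII.5 Prop. 5.1, X.2 Prop. 2.4, App. C §16] [cite: IrelandRosen1982, Ch. 5 §2]
[cite: GrossLMS1991, §5 Prop. 5.3]
presearch: «conductor of a quadratic twist at primes not dividing the discriminant of the twisting field; a_p of twist = χ(p) a_p» →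
tree: `factorization_conductorNorm_quadraticTwist_eq_of_not_dvd` (Literature), `GenusGrossZagier.*_of_one_mod_four` (bsd-addord, same
content with heavier imports — cited, re-derived here on the light closure), part 19 §1; [corpus:SilvermanATAEC1994 IV.9.4]; nothing restated
beyond the `−3`-specialisation (corpus+galaxy).
-/

set_option linter.dupNamespace false
set_option autoImplicit false

noncomputable section

open scoped Classical NumberField

namespace Summit.BirchSwinnertonDyer.BirchSwinnertonDyer.Theorems.LeafPartnerFrameTransfer

open WeierstrassCurve NumberField IsDedekindDomain Rat.HeightOneSpectrum
  Literature.NumberTheory.EllipticCurves Literature.NumberTheory.EllipticCurves.RingClassField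
  Literature.NumberTheory.Automorphic
  Summit.BirchSwinnertonDyer.BirchSwinnertonDyer.Theorems.LeafPartnerGenusLabelB4

/-! ## §1 Frame transfer `W → V` at the primes `ℓ ≠ 3` -/

section Frame

variable (W : WeierstrassCurve ℚ) [W.IsElliptic] {V : WeierstrassCurve ℚ} [V.IsElliptic]

/-- **Conductor exponents of the partner**: for `V = CV • W^{(−3)}` and a prime `ℓ ≠ 3`, `ord_ℓ N_V = ord_ℓ N_W`
(`−3 ≡ 1 (mod 4)` and `ℓ ∤ 3`: the tree's `factorization_conductorNorm_quadraticTwist_eq_of_not_dvd`; the conductor is an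
isomorphism invariant, `conductorNorm_int_smul`). [cite: SilvermanATAEC1994, IV.9.4] [cite: SilvermanAEC2009, App. C §16] -/
theorem factorization_conductorNorm_partner (CV : VariableChange ℚ) (hV : CV • W.quadraticTwist (-3) = V)
    {ℓ : ℕ} (hℓ : ℓ.Prime) (hℓ3 : ℓ ≠ 3) :
    (V.conductorNorm ℤ).factorization ℓ = (W.conductorNorm ℤ).factorization ℓ := by
  subst hV
  have hd : (-3 : ℚ) ≠ 0 := by norm_num
  haveI := W.isElliptic_quadraticTwist hd
  obtain ⟨v, hv⟩ : ∃ v : HeightOneSpectrum ℤ, natGenerator v = ℓ :=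
    ⟨(primesEquiv (R := ℤ)).symm ⟨ℓ, hℓ⟩, congrArg Subtype.val ((primesEquiv (R := ℤ)).apply_symm_apply ⟨ℓ, hℓ⟩)⟩
  have hvd : ¬ ((natGenerator v : ℕ) : ℤ) ∣ (-3 : ℤ) := by
    rw [hv]
    intro h
    have h3 : ℓ ∣ 3 := by exact_mod_cast (dvd_neg.mp h)
    exact hℓ3 ((Nat.prime_dvd_prime_iff_eq hℓ Nat.prime_three).mp h3)
  have key := W.factorization_conductorNorm_quadraticTwist_eq_of_not_dvd (d := -3) (by decide) v hvd
  rw [hv] at key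
  rw [conductorNorm_int_smul, ← key]
  congr 3

/-- **`ℓ ∣ N_V ⟺ ℓ ∣ N_W`** for a prime `ℓ ≠ 3`. [cite: SilvermanATAEC1994, IV.9.4] -/
theorem dvd_conductorNorm_partner_iff (CV : VariableChange ℚ) (hV : CV • W.quadraticTwist (-3) = V)
    {ℓ : ℕ} (hℓ : ℓ.Prime) (hℓ3 : ℓ ≠ 3) :
    ℓ ∣ V.conductorNorm ℤ ↔ ℓ ∣ W.conductorNorm ℤ := by
  have hV0 : V.conductorNorm ℤ ≠ 0 := (V.conductorNorm_pos_holds).ne'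
  have hW0 : W.conductorNorm ℤ ≠ 0 := (W.conductorNorm_pos_holds).ne'
  rw [hℓ.dvd_iff_one_le_factorization hV0, hℓ.dvd_iff_one_le_factorization hW0,
    factorization_conductorNorm_partner W CV hV hℓ hℓ3]

/-- **Good reduction transfers between `W` and its partner at a prime `ℓ ≠ 3`** (`ℓ ∣ N ⟺` bad reduction).
[cite: SilvermanAEC2009, VII.5 Prop. 5.1, App. C §16] -/
theorem hasGoodReductionAtPrime_partner_iff (CV : VariableChange ℚ) (hV : CV • W.quadraticTwist (-3) = V)
    {ℓ : ℕ} [hℓ : Fact ℓ.Prime] (hℓ3 : ℓ ≠ 3) :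
    V.HasGoodReductionAtPrime ℓ ↔ W.HasGoodReductionAtPrime ℓ := by
  rw [← not_iff_not, ← V.dvd_conductorNorm_iff_not_hasGoodReductionAtPrime ℓ,
    ← W.dvd_conductorNorm_iff_not_hasGoodReductionAtPrime ℓ]
  exact dvd_conductorNorm_partner_iff W CV hV hℓ.out hℓ3

/-- **`a_ℓ(W) = χ₋₃(ℓ)·a_ℓ(V)`** at a prime `ℓ ≠ 3` of good reduction, `χ₋₃(ℓ) = (−3∕ℓ) = (if ℓ ≡ 1 (3) then 1 else −1)`, for `W`, `V`
globally minimal: odd `ℓ` by part 19 §1 (`a_ℓ(W) = (−3∕ℓ)a_ℓ(V)`) and `(−3∕ℓ)` by residue class (`Brandt.legendreSym_neg_three_eq`); `ℓ = 2` by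
the tree's `GoldfeldGoodTwists.hasGoodReductionAtPrime_and_frobeniusTrace_of_smul_eq_quadraticTwist_two` (`−3 ≡ 5 (mod 8)`: `a₂(V) = −a₂(W)`).
[cite: SilvermanAEC2009, X.2 Prop. 2.4, Exercise 10.16] [cite: IrelandRosen1982, Ch. 5 §2] -/
theorem frobeniusTrace_partner_chi [W.IsGloballyMinimal] [V.IsGloballyMinimal] (CV : VariableChange ℚ)
    (hV : CV • W.quadraticTwist (-3) = V) {ℓ : ℕ} [hℓ : Fact ℓ.Prime] (hℓ3 : ℓ ≠ 3) (hgood : W.HasGoodReductionAtPrime ℓ) :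
    W.frobeniusTrace ℓ = (if ℓ % 3 = 1 then 1 else -1) * V.frobeniusTrace ℓ := by
  have hgoodV : V.HasGoodReductionAtPrime ℓ := (hasGoodReductionAtPrime_partner_iff W CV hV hℓ3).mpr hgood
  by_cases hℓ2 : ℓ = 2
  · subst hℓ2
    have hC : CV⁻¹ • V = W.quadraticTwist ((-3 : ℤ) : ℚ) := by
      rw [← hV, inv_smul_smul]; norm_num
    have h := (GoldfeldGoodTwists.hasGoodReductionAtPrime_and_frobeniusTrace_of_smul_eq_quadraticTwist_two W V
      (d := -3) (by decide) hC 2 rfl hgood).2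
    rw [if_neg (by decide)] at h
    rw [if_neg (by decide), h]
    ring
  · rw [frobeniusTrace_partner W CV hV hℓ2 hℓ3 hgood hgoodV, ← jacobiSym.legendreSym.to_jacobiSym,
      Brandt.legendreSym_neg_three_eq hℓ2 hℓ3]

end Frame

/-! ## §2 Bookkeeping: `χ₋₃` is multiplicative; the genus sign depends only on complex values -/

/-- `χ₋₃(ab) = χ₋₃(a)χ₋₃(b)` for `3 ∤ a`, `3 ∤ b` (`χ₋₃(n) := 1` if `n ≡ 1 (3)`, `−1` otherwise). [folklore] -/
theorem chi3_mul {a b : ℕ} (ha : ¬ 3 ∣ a) (hb : ¬ 3 ∣ b) :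
    (if (a * b) % 3 = 1 then (1 : ℤ) else -1) = (if a % 3 = 1 then (1 : ℤ) else -1) * (if b % 3 = 1 then (1 : ℤ) else -1) := by
  have ha' : a % 3 = 1 ∨ a % 3 = 2 := by omega
  have hb' : b % 3 = 1 ∨ b % 3 = 2 := by omega
  rcases ha' with ha' | ha' <;> rcases hb' with hb' | hb' <;> simp [Nat.mul_mod, ha', hb']

variable {K : Type} [Field K] [NumberField K]

/-- **The genus sign depends only on complex values**: for roots `θ ∈ K[n]`, `θ′ ∈ K[n′]` of the same complex number and
automorphisms `σ`, `σ′` with `(σ θ : ℂ) = (σ′ θ′ : ℂ)`: `genusSign θ σ = genusSign θ′ σ′`. (The (B3χ) pin: `σ′` restricts to `σ₃`.)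
[cite: GrossLMS1991, §5 Prop. 5.3] -/
theorem genusSign_eq_of_coe_eq (ι : K →+* ℂ) {n n' : ℕ} {θ : ringClassField K ι n} {θ' : ringClassField K ι n'}
    {σ : ringClassField K ι n ≃ₐ[ℚ] ringClassField K ι n} {σ' : ringClassField K ι n' ≃ₐ[ℚ] ringClassField K ι n'}
    (hθ : (θ : ℂ) = (θ' : ℂ)) (hσ : ((σ θ : ringClassField K ι n) : ℂ) = ((σ' θ' : ringClassField K ι n') : ℂ)) :
    genusSign θ σ = genusSign θ' σ' := by
  have key : σ θ = θ ↔ σ' θ' = θ' := by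
    constructor
    · intro h
      apply Subtype.ext
      rw [← hσ, h, hθ]
    · intro h
      apply Subtype.ext
      rw [hσ, h, hθ]
  unfold genusSign
  by_cases h : σ' θ' = θ'
  · rw [if_pos h, if_pos (key.mpr h)]
  · rw [if_neg h, if_neg (fun h' => h (key.mp h'))]

end Summit.BirchSwinnertonDyer.BirchSwinnertonDyer.Theorems.LeafPartnerFrameTransfer

end
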